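import Literature.Analysis.FluidPDE.HeatDivFormGradientL2
import Literature.Analysis.FluidPDE.NSSpinHeatEquationProofs
import HarnessLib

/-!
# ScalingDefectPeepholeDoorSerrinPointwise — door S30 «ScalingDefectPeepholeDoor», effective plate E0 (step E1a):
# pointwise calculus of the localised Duhamel test function `φ 𝒰[ξ]`

Door S30 (`Theorems/ScalingDefectPeepholeDoorDefs.lean`) is closed by name (`targetVortexDefectPeephole_holds`,
p620717); its LEG Cω `quietVortexCoreRigidity_holds` produces the lateness `s₁` AFTER the annular pressure
level `C_p`, because the one-slice derivative bounds it consumes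
(`Literature.Analysis.FluidPDE.exists_forall_iteratedFDeriv_le_of_typeI_of_bounds`) hold below a scale
`c₁(B_u, B_p)` that depends on the pressure.  The effective order `QuietVortexCoreRigidityU`
(nsreg-p1 g25, Sketch31 v2.1 Part B; ADDENDUM-28A: "the vorticity-side envelopes are pressure-free,
Serrin 1962") needs interior derivative bounds for bounded solutions that never read the pressure
(Serrin 1962; Chen–Strain–Tsai–Yau 2009, Lemma A.2; Pineau–Vicol 2026, Lemma 9.1).  The chain
`…SerrinPointwise` → `…SerrinSlab` → `…SerrinSpinDuality` → `…SerrinSpinL2` supplies the missing `L²`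
START of Serrin's bootstrap (the tree's `NSBootstrap.spin_bound_backward_quant` / `level_step` are
already pressure-free) by DUALITY with the backward caloric Duhamel integral `𝒰[ξ]`, one derivative
below the tree's `HeatDivForm.heatDivForm_gradient_L2_top`.

This file: the heat operator on `φ U` (`(∂ₜ + Δ)(φU) = -φξ + ϑ`,
`ϑ = (∂ₜφ + Δφ)U + 2Σᵢ ∂ᵢφ ∂ᵢU` for `U = 𝒰[ξ]`), a single sup constant for the cut-off, and the
pointwise bounds `‖∂ᵥϑ‖, ‖∂_w∂_v(φU)‖ ≲ |U| + ‖DU‖ + ‖D²U‖ ≤ √3 · (frame energy density)^{1/2}` — the only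
derivatives of `U` that ever appear are of order `≤ 2`, which is what the `L²` maximal regularity of
the heat equation controls.

Door S30 is a regularity CRITERION inside a HYPOTHETICAL local Type-I blow-up; item 0056 `NoTypeII`
stays OPEN; nothing here bears on NS regularity itself.
-/

noncomputable section

set_option linter.dupNamespace false

namespace Summit.NavierStokesRegularity.NavierStokesRegularity.Theorems.ScalingDefectPeepholeDoor

namespace Serrin

open MeasureTheory Set Function Filter Topology TopologicalSpace Metric InnerProductSpace
open scoped NNReal ENNReal RealInnerProductSpace Laplacian ContDiff
open Literature.Analysis Literature.Analysis.FluidPDE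

/-! ### Pointwise calculus of the localised Duhamel test function `φ 𝒰[ξ]` -/

section Pointwise

variable {E : Type*} [NormedAddCommGroup E] [InnerProductSpace ℝ E] [FiniteDimensional ℝ E]
  [MeasurableSpace E] [BorelSpace E]

/-- **The heat operator on `φ 𝒰[ξ]`**: `(∂ₜ + Δ)(φU) = -φξ + (∂ₜφ + Δφ)U + 2Σᵢ ∂ᵢφ ∂ᵢU` for
`U = 𝒰[ξ]` (`∂ₜU + ΔU = -ξ`). [folklore] -/
theorem heat_cutoff_duhamel {φ ξ : ℝ → E → ℝ} (hφ : IsSpaceTimeTestOn (⊤ : Opens (ℝ × E)) φ)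
    (hξ : IsSpaceTimeTestOn (⊤ : Opens (ℝ × E)) ξ) (t : ℝ) (x : E) :
    timeDeriv (fun s y => φ s y * heatDuhamelBack 1 ξ s y) t x +
        (Δ (fun y => φ t y * heatDuhamelBack 1 ξ t y)) x =
      -(φ t x * ξ t x) +
        ((timeDeriv φ t x + (Δ (φ t)) x) * heatDuhamelBack 1 ξ t x +
          2 * ∑ i, fderiv ℝ (φ t) x (stdOrthonormalBasis ℝ E i) *
            fderiv ℝ (heatDuhamelBack 1 ξ t) x (stdOrthonormalBasis ℝ E i)) := by
  set U : ℝ → E → ℝ := heatDuhamelBack 1 ξ with hU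
  have hUs : ContDiff ℝ ((⊤ : ℕ∞) : WithTop ℕ∞) (uncurry U) :=
    hξ.contDiff_uncurry_heatDuhamelBack_infty one_pos
  have hφs : ContDiff ℝ ((⊤ : ℕ∞) : WithTop ℕ∞) (uncurry φ) := hφ.contDiff
  have hφ2 : ContDiff ℝ 2 (φ t) := (hφ.contDiff_slice t).of_le two_le_infty
  have hU2 : ContDiff ℝ 2 (U t) := (contDiff_slice_of_uncurry hUs t).of_le two_le_infty
  have e1 : timeDeriv (fun s y => φ s y * U s y) t x =
      timeDeriv φ t x * U t x + φ t x * timeDeriv U t x :=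
    timeDeriv_mul (differentiableAt_time_of_uncurry hφs (by simp) t x)
      (differentiableAt_time_of_uncurry hUs (by simp) t x)
  have e2 := laplacian_mul_eq (stdOrthonormalBasis ℝ E) hφ2 hU2 x
  have e3 : timeDeriv U t x + (Δ (U t)) x = -ξ t x :=
    timeDeriv_add_laplacian_heatDuhamelBack_one hξ t x
  rw [e1, e2]
  linear_combination φ t x * e3

omit [FiniteDimensional ℝ E] [MeasurableSpace E] [BorelSpace E] in
/-- `‖Df(x) v‖ ≤ ‖Df(x)‖ ‖v‖` (operator norm). [folklore] -/
theorem norm_fderiv_apply_le' {f : E → ℝ} (x v : E) : ‖fderiv ℝ f x v‖ ≤ ‖fderiv ℝ f x‖ * ‖v‖ :=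
  ContinuousLinearMap.le_opNorm _ _

omit [FiniteDimensional ℝ E] [MeasurableSpace E] [BorelSpace E] in
/-- Mixed second derivative through the second Fréchet derivative:
`∂_w ∂_v f (x) = D²f(x)(w)(v)`, hence `‖∂_w∂_v f(x)‖ ≤ ‖D²f(x)‖ ‖w‖ ‖v‖`, for `f ∈ C²`. [folklore] -/
theorem norm_fderiv_fderiv_apply_le' {f : E → ℝ} (hf : ContDiff ℝ 2 f) (x v w : E) :
    ‖fderiv ℝ (fun y => fderiv ℝ f y v) x w‖ ≤ ‖fderiv ℝ (fderiv ℝ f) x‖ * ‖w‖ * ‖v‖ := by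
  have hd : DifferentiableAt ℝ (fderiv ℝ f) x :=
    ((hf.fderiv_right (m := 1) le_rfl).differentiable one_ne_zero) x
  have he : fderiv ℝ (fun y => fderiv ℝ f y v) x w = fderiv ℝ (fderiv ℝ f) x w v := by
    rw [fderiv_clm_apply hd (differentiableAt_const _)]
    simp
  rw [he]
  exact (ContinuousLinearMap.le_opNorm _ _).trans
    (mul_le_mul_of_nonneg_right (ContinuousLinearMap.le_opNorm _ _) (norm_nonneg _))

omit [MeasurableSpace E] [BorelSpace E] in
/-- **A sup bound for all `φ`-coefficients at once.** For a global test field `φ` there is `K ≥ 1`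
bounding `|φ|`, `|∂ₜφ + Δφ|`, `‖D(∂ₜφ + Δφ)‖`, `‖Dφ‖`, `‖D²φ‖` everywhere. [folklore] -/
theorem exists_cutoff_bound {φ : ℝ → E → ℝ} (hφ : IsSpaceTimeTestOn (⊤ : Opens (ℝ × E)) φ) :
    ∃ K : ℝ, 1 ≤ K ∧ (∀ t x, ‖φ t x‖ ≤ K) ∧
      (∀ t x, ‖timeDeriv φ t x + (Δ (φ t)) x‖ ≤ K) ∧
      (∀ t x, ‖fderiv ℝ (fun y => timeDeriv φ t y + (Δ (φ t)) y) x‖ ≤ K) ∧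
      (∀ t x, ‖fderiv ℝ (φ t) x‖ ≤ K) ∧
      (∀ t x, ‖fderiv ℝ (fderiv ℝ (φ t)) x‖ ≤ K) := by
  have ha : IsSpaceTimeTestOn (⊤ : Opens (ℝ × E)) (fun t y => timeDeriv φ t y + (Δ (φ t)) y) :=
    NSSpinHeat.isSpaceTimeTestOn_add hφ.timeDeriv_top hφ.laplacian_top
  obtain ⟨K₀, hK₀0, hK₀⟩ := hφ.exists_norm_le
  obtain ⟨Ka, hKa0, hKa⟩ := ha.exists_norm_le
  obtain ⟨Kda, hKda0, hKda⟩ := ha.fderiv_top.exists_norm_le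
  obtain ⟨Kg, hKg0, hKg⟩ := hφ.fderiv_top.exists_norm_le
  obtain ⟨Kgg, hKgg0, hKgg⟩ := hφ.fderiv_top.fderiv_top.exists_norm_le
  refine ⟨1 + K₀ + Ka + Kda + Kg + Kgg, by linarith, fun t x => ?_, fun t x => ?_, fun t x => ?_,
    fun t x => ?_, fun t x => ?_⟩
  · exact (hK₀ t x).trans (by linarith)
  · exact (hKa t x).trans (by linarith)
  · exact (hKda t x).trans (by linarith)
  · exact (hKg t x).trans (by linarith)
  · exact (hKgg t x).trans (by linarith)

omit [MeasurableSpace E] [BorelSpace E] in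
/-- **Derivative bound for the localisation remainder** `ϑ = (∂ₜφ + Δφ)U + 2Σᵢ ∂ᵢφ ∂ᵢU`:
`ϑ` is differentiable in `x` and `‖∂ᵥϑ‖ ≤ 6n K ‖v‖ (|U| + ‖DU‖ + ‖D²U‖)` with the constant of
`exists_cutoff_bound` (`n = dim E`; any `C²` function `U`). [folklore] -/
theorem fderiv_remainder_bound {φ : ℝ → E → ℝ} (hφ : IsSpaceTimeTestOn (⊤ : Opens (ℝ × E)) φ)
    {K : ℝ} (hK1 : 1 ≤ K) (hKa : ∀ t x, ‖timeDeriv φ t x + (Δ (φ t)) x‖ ≤ K)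
    (hKda : ∀ t x, ‖fderiv ℝ (fun y => timeDeriv φ t y + (Δ (φ t)) y) x‖ ≤ K)
    (hKg : ∀ t x, ‖fderiv ℝ (φ t) x‖ ≤ K) (hKgg : ∀ t x, ‖fderiv ℝ (fderiv ℝ (φ t)) x‖ ≤ K)
    {U : E → ℝ} (hU : ContDiff ℝ 2 U) (t : ℝ) (x v : E) :
    DifferentiableAt ℝ (fun y => (timeDeriv φ t y + (Δ (φ t)) y) * U y +
        2 * ∑ i, fderiv ℝ (φ t) y (stdOrthonormalBasis ℝ E i) *
          fderiv ℝ U y (stdOrthonormalBasis ℝ E i)) x ∧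
      ‖fderiv ℝ (fun y => (timeDeriv φ t y + (Δ (φ t)) y) * U y +
          2 * ∑ i, fderiv ℝ (φ t) y (stdOrthonormalBasis ℝ E i) *
            fderiv ℝ U y (stdOrthonormalBasis ℝ E i)) x v‖ ≤
        (2 + 4 * (Module.finrank ℝ E : ℝ)) * K * ‖v‖ *
          (‖U x‖ + ‖fderiv ℝ U x‖ + ‖fderiv ℝ (fderiv ℝ U) x‖) := by
  set bs := stdOrthonormalBasis ℝ E with hbs
  set a : E → ℝ := fun y => timeDeriv φ t y + (Δ (φ t)) y with ha
  have ha_test : IsSpaceTimeTestOn (⊤ : Opens (ℝ × E)) (fun t y => timeDeriv φ t y + (Δ (φ t)) y) :=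
    NSSpinHeat.isSpaceTimeTestOn_add hφ.timeDeriv_top hφ.laplacian_top
  have had : DifferentiableAt ℝ a x := ((ha_test.contDiff_slice t).differentiable (by simp)) x
  have hU1 : ContDiff ℝ 1 U := hU.of_le one_le_two
  have hUd : DifferentiableAt ℝ U x := (hU1.differentiable one_ne_zero) x
  have hDUd : DifferentiableAt ℝ (fderiv ℝ U) x :=
    ((hU.fderiv_right (m := 1) le_rfl).differentiable one_ne_zero) x
  have hφ2 : ContDiff ℝ 2 (φ t) := (hφ.contDiff_slice t).of_le two_le_infty
  have hDφd : DifferentiableAt ℝ (fderiv ℝ (φ t)) x :=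
    ((hφ2.fderiv_right (m := 1) le_rfl).differentiable one_ne_zero) x
  -- the pieces `gᵢ = ∂ᵢφ`, `dᵢ = ∂ᵢU`
  have hgd : ∀ i, DifferentiableAt ℝ (fun y => fderiv ℝ (φ t) y (bs i)) x := fun i =>
    hDφd.clm_apply (differentiableAt_const _)
  have hdd : ∀ i, DifferentiableAt ℝ (fun y => fderiv ℝ U y (bs i)) x := fun i =>
    hDUd.clm_apply (differentiableAt_const _)
  have hprod : ∀ i, DifferentiableAt ℝ (fun y => fderiv ℝ (φ t) y (bs i) * fderiv ℝ U y (bs i)) x :=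
    fun i => (hgd i).mul (hdd i)
  have hsum : DifferentiableAt ℝ (fun y => ∑ i, fderiv ℝ (φ t) y (bs i) * fderiv ℝ U y (bs i)) x :=
    DifferentiableAt.fun_sum fun i _ => hprod i
  have h1 : DifferentiableAt ℝ (fun y => a y * U y) x := had.mul hUd
  have h2 : DifferentiableAt ℝ (fun y => 2 * ∑ i, fderiv ℝ (φ t) y (bs i) * fderiv ℝ U y (bs i)) x :=
    (differentiableAt_const _).mul hsum
  refine ⟨h1.add h2, ?_⟩
  -- the derivative, term by term
  have e0 : fderiv ℝ (fun y => a y * U y + 2 * ∑ i, fderiv ℝ (φ t) y (bs i) * fderiv ℝ U y (bs i)) x v =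
      fderiv ℝ (fun y => a y * U y) x v +
        fderiv ℝ (fun y => 2 * ∑ i, fderiv ℝ (φ t) y (bs i) * fderiv ℝ U y (bs i)) x v := by
    rw [fderiv_fun_add h1 h2]; rfl
  have e1 : fderiv ℝ (fun y => a y * U y) x v = a x * fderiv ℝ U x v + U x * fderiv ℝ a x v := by
    rw [fderiv_fun_mul had hUd]
    simp only [_root_.add_apply, FunLike.coe_smul, Pi.smul_apply, smul_eq_mul]
  have e2 : fderiv ℝ (fun y => 2 * ∑ i, fderiv ℝ (φ t) y (bs i) * fderiv ℝ U y (bs i)) x v =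
      2 * ∑ i, (fderiv ℝ (φ t) x (bs i) * fderiv ℝ (fun y => fderiv ℝ U y (bs i)) x v +
        fderiv ℝ U x (bs i) * fderiv ℝ (fun y => fderiv ℝ (φ t) y (bs i)) x v) := by
    rw [fderiv_fun_mul (differentiableAt_const _) hsum]
    simp only [fderiv_fun_const, Pi.zero_apply, smul_zero, add_zero]
    rw [fderiv_fun_sum fun i _ => hprod i]
    simp only [FunLike.coe_smul, Pi.smul_apply, smul_eq_mul, FunLike.coe_sum,
      Finset.sum_apply]
    congr 1
    refine Finset.sum_congr rfl fun i _ => ?_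
    rw [fderiv_fun_mul (hgd i) (hdd i)]
    simp only [_root_.add_apply, FunLike.coe_smul, Pi.smul_apply, smul_eq_mul]
  -- pointwise sizes
  have hv0 : 0 ≤ ‖v‖ := norm_nonneg _
  have hK0 : 0 ≤ K := by linarith
  set R : ℝ := ‖U x‖ + ‖fderiv ℝ U x‖ + ‖fderiv ℝ (fderiv ℝ U) x‖ with hR
  have hR0 : 0 ≤ R := by positivity
  have hRU : ‖U x‖ ≤ R := by rw [hR]; linarith [norm_nonneg (fderiv ℝ U x), norm_nonneg (fderiv ℝ (fderiv ℝ U) x)]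
  have hRD : ‖fderiv ℝ U x‖ ≤ R := by rw [hR]; linarith [norm_nonneg (U x), norm_nonneg (fderiv ℝ (fderiv ℝ U) x)]
  have hRDD : ‖fderiv ℝ (fderiv ℝ U) x‖ ≤ R := by rw [hR]; linarith [norm_nonneg (U x), norm_nonneg (fderiv ℝ U x)]
  have hbi : ∀ i, ‖bs i‖ = 1 := fun i => bs.orthonormal.1 i
  -- term 1
  have t1 : ‖a x * fderiv ℝ U x v + U x * fderiv ℝ a x v‖ ≤ 2 * K * ‖v‖ * R := by
    have b1 : ‖a x * fderiv ℝ U x v‖ ≤ K * (R * ‖v‖) := by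
      rw [norm_mul]
      exact mul_le_mul (hKa t x) ((norm_fderiv_apply_le' x v).trans
        (mul_le_mul_of_nonneg_right hRD hv0)) (norm_nonneg _) hK0
    have b2 : ‖U x * fderiv ℝ a x v‖ ≤ R * (K * ‖v‖) := by
      rw [norm_mul]
      exact mul_le_mul hRU ((norm_fderiv_apply_le' x v).trans
        (mul_le_mul_of_nonneg_right (hKda t x) hv0)) (norm_nonneg _) hR0
    calc ‖a x * fderiv ℝ U x v + U x * fderiv ℝ a x v‖
        ≤ ‖a x * fderiv ℝ U x v‖ + ‖U x * fderiv ℝ a x v‖ := norm_add_le _ _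
      _ ≤ K * (R * ‖v‖) + R * (K * ‖v‖) := add_le_add b1 b2
      _ = 2 * K * ‖v‖ * R := by ring
  -- term 2, summand by summand
  have t2i : ∀ i, ‖fderiv ℝ (φ t) x (bs i) * fderiv ℝ (fun y => fderiv ℝ U y (bs i)) x v +
      fderiv ℝ U x (bs i) * fderiv ℝ (fun y => fderiv ℝ (φ t) y (bs i)) x v‖ ≤ 2 * K * ‖v‖ * R := by
    intro i
    have c1 : ‖fderiv ℝ (φ t) x (bs i)‖ ≤ K := by
      refine (norm_fderiv_apply_le' x (bs i)).trans ?_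
      rw [hbi, mul_one]; exact hKg t x
    have c2 : ‖fderiv ℝ (fun y => fderiv ℝ U y (bs i)) x v‖ ≤ R * ‖v‖ := by
      refine (norm_fderiv_fderiv_apply_le' hU x (bs i) v).trans ?_
      rw [hbi, mul_one]
      exact mul_le_mul_of_nonneg_right hRDD hv0
    have c3 : ‖fderiv ℝ U x (bs i)‖ ≤ R := by
      refine (norm_fderiv_apply_le' x (bs i)).trans ?_
      rw [hbi, mul_one]; exact hRD
    have c4 : ‖fderiv ℝ (fun y => fderiv ℝ (φ t) y (bs i)) x v‖ ≤ K * ‖v‖ := by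
      refine (norm_fderiv_fderiv_apply_le' hφ2 x (bs i) v).trans ?_
      rw [hbi, mul_one]
      exact mul_le_mul_of_nonneg_right (hKgg t x) hv0
    calc ‖fderiv ℝ (φ t) x (bs i) * fderiv ℝ (fun y => fderiv ℝ U y (bs i)) x v +
          fderiv ℝ U x (bs i) * fderiv ℝ (fun y => fderiv ℝ (φ t) y (bs i)) x v‖
        ≤ ‖fderiv ℝ (φ t) x (bs i)‖ * ‖fderiv ℝ (fun y => fderiv ℝ U y (bs i)) x v‖ +
          ‖fderiv ℝ U x (bs i)‖ * ‖fderiv ℝ (fun y => fderiv ℝ (φ t) y (bs i)) x v‖ := by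
            refine (norm_add_le _ _).trans (add_le_add ?_ ?_) <;> rw [norm_mul]
      _ ≤ K * (R * ‖v‖) + R * (K * ‖v‖) :=
            add_le_add (mul_le_mul c1 c2 (norm_nonneg _) hK0) (mul_le_mul c3 c4 (norm_nonneg _) hR0)
      _ = 2 * K * ‖v‖ * R := by ring
  have t2 : ‖2 * ∑ i, (fderiv ℝ (φ t) x (bs i) * fderiv ℝ (fun y => fderiv ℝ U y (bs i)) x v +
      fderiv ℝ U x (bs i) * fderiv ℝ (fun y => fderiv ℝ (φ t) y (bs i)) x v)‖ ≤
      4 * (Module.finrank ℝ E : ℝ) * K * ‖v‖ * R := by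
    rw [norm_mul, Real.norm_two]
    have hs := (norm_sum_le _ _).trans (Finset.sum_le_sum fun i (_ : i ∈ Finset.univ) => t2i i)
    rw [Finset.sum_const, Finset.card_univ, nsmul_eq_mul] at hs
    have hcard : (Fintype.card (Fin (Module.finrank ℝ E)) : ℝ) = (Module.finrank ℝ E : ℝ) := by
      rw [Fintype.card_fin]
    rw [hcard] at hs
    calc 2 * ‖∑ i, (fderiv ℝ (φ t) x (bs i) * fderiv ℝ (fun y => fderiv ℝ U y (bs i)) x v +
          fderiv ℝ U x (bs i) * fderiv ℝ (fun y => fderiv ℝ (φ t) y (bs i)) x v)‖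
        ≤ 2 * ((Module.finrank ℝ E : ℝ) * (2 * K * ‖v‖ * R)) := by gcongr
      _ = 4 * (Module.finrank ℝ E : ℝ) * K * ‖v‖ * R := by ring
  rw [e0, e1, e2]
  calc ‖a x * fderiv ℝ U x v + U x * fderiv ℝ a x v +
        2 * ∑ i, (fderiv ℝ (φ t) x (bs i) * fderiv ℝ (fun y => fderiv ℝ U y (bs i)) x v +
          fderiv ℝ U x (bs i) * fderiv ℝ (fun y => fderiv ℝ (φ t) y (bs i)) x v)‖
      ≤ 2 * K * ‖v‖ * R + 4 * (Module.finrank ℝ E : ℝ) * K * ‖v‖ * R :=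
        (norm_add_le _ _).trans (add_le_add t1 t2)
    _ = (2 + 4 * (Module.finrank ℝ E : ℝ)) * K * ‖v‖ * R := by ring

omit [FiniteDimensional ℝ E] [MeasurableSpace E] [BorelSpace E] in
/-- **Second derivatives of the localised test function**: for `C²` functions `φ₀, U` on `E`,
`∂_w ∂_v(φ₀ U) = ∂_w∂_vφ₀ U + ∂_vφ₀ ∂_wU + ∂_wφ₀ ∂_vU + φ₀ ∂_w∂_vU`, hence
`‖∂_w∂_v(φ₀U)‖ ≤ 4 K ‖v‖ ‖w‖ (|U| + ‖DU‖ + ‖D²U‖)` when `|φ₀|, ‖Dφ₀‖, ‖D²φ₀‖ ≤ K`. [folklore] -/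
theorem fderiv_fderiv_mul_bound {φ₀ U : E → ℝ} (hφ₀ : ContDiff ℝ 2 φ₀) (hU : ContDiff ℝ 2 U)
    {K : ℝ} (hK1 : 1 ≤ K) (hK₀ : ∀ x, ‖φ₀ x‖ ≤ K) (hKg : ∀ x, ‖fderiv ℝ φ₀ x‖ ≤ K)
    (hKgg : ∀ x, ‖fderiv ℝ (fderiv ℝ φ₀) x‖ ≤ K) (x v w : E) :
    ‖fderiv ℝ (fun y => fderiv ℝ (fun z => φ₀ z * U z) y v) x w‖ ≤
      4 * K * ‖v‖ * ‖w‖ * (‖U x‖ + ‖fderiv ℝ U x‖ + ‖fderiv ℝ (fderiv ℝ U) x‖) := by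
  have hφ1 : ContDiff ℝ 1 φ₀ := hφ₀.of_le one_le_two
  have hU1 : ContDiff ℝ 1 U := hU.of_le one_le_two
  have hφd : ∀ y, DifferentiableAt ℝ φ₀ y := fun y => (hφ1.differentiable one_ne_zero) y
  have hUd : ∀ y, DifferentiableAt ℝ U y := fun y => (hU1.differentiable one_ne_zero) y
  have hDUd : DifferentiableAt ℝ (fderiv ℝ U) x :=
    ((hU.fderiv_right (m := 1) le_rfl).differentiable one_ne_zero) x
  have hDφd : DifferentiableAt ℝ (fderiv ℝ φ₀) x :=
    ((hφ₀.fderiv_right (m := 1) le_rfl).differentiable one_ne_zero) x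
  -- the first derivative as a function
  have h1 : (fun y => fderiv ℝ (fun z => φ₀ z * U z) y v) =
      fun y => φ₀ y * fderiv ℝ U y v + U y * fderiv ℝ φ₀ y v := by
    funext y
    rw [fderiv_fun_mul (hφd y) (hUd y)]
    simp only [_root_.add_apply, FunLike.coe_smul, Pi.smul_apply, smul_eq_mul]
  have hdUv : DifferentiableAt ℝ (fun y => fderiv ℝ U y v) x := hDUd.clm_apply (differentiableAt_const _)
  have hdφv : DifferentiableAt ℝ (fun y => fderiv ℝ φ₀ y v) x := hDφd.clm_apply (differentiableAt_const _)
  have hA : DifferentiableAt ℝ (fun y => φ₀ y * fderiv ℝ U y v) x := (hφd x).mul hdUv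
  have hB : DifferentiableAt ℝ (fun y => U y * fderiv ℝ φ₀ y v) x := (hUd x).mul hdφv
  have e : fderiv ℝ (fun y => fderiv ℝ (fun z => φ₀ z * U z) y v) x w =
      (φ₀ x * fderiv ℝ (fun y => fderiv ℝ U y v) x w + fderiv ℝ U x v * fderiv ℝ φ₀ x w) +
        (U x * fderiv ℝ (fun y => fderiv ℝ φ₀ y v) x w + fderiv ℝ φ₀ x v * fderiv ℝ U x w) := by
    rw [h1, fderiv_fun_add hA hB, fderiv_fun_mul (hφd x) hdUv, fderiv_fun_mul (hUd x) hdφv]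
    simp only [_root_.add_apply, FunLike.coe_smul, Pi.smul_apply, smul_eq_mul]
  rw [e]
  have hv0 : 0 ≤ ‖v‖ := norm_nonneg _
  have hw0 : 0 ≤ ‖w‖ := norm_nonneg _
  have hK0 : 0 ≤ K := by linarith
  set R : ℝ := ‖U x‖ + ‖fderiv ℝ U x‖ + ‖fderiv ℝ (fderiv ℝ U) x‖ with hR
  have hR0 : 0 ≤ R := by positivity
  have hRU : ‖U x‖ ≤ R := by rw [hR]; linarith [norm_nonneg (fderiv ℝ U x), norm_nonneg (fderiv ℝ (fderiv ℝ U) x)]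
  have hRD : ‖fderiv ℝ U x‖ ≤ R := by rw [hR]; linarith [norm_nonneg (U x), norm_nonneg (fderiv ℝ (fderiv ℝ U) x)]
  have hRDD : ‖fderiv ℝ (fderiv ℝ U) x‖ ≤ R := by rw [hR]; linarith [norm_nonneg (U x), norm_nonneg (fderiv ℝ U x)]
  have b1 : ‖φ₀ x * fderiv ℝ (fun y => fderiv ℝ U y v) x w‖ ≤ K * (R * ‖w‖ * ‖v‖) := by
    rw [norm_mul]
    refine mul_le_mul (hK₀ x) ((norm_fderiv_fderiv_apply_le' hU x v w).trans ?_) (norm_nonneg _) hK0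
    gcongr
  have b2 : ‖fderiv ℝ U x v * fderiv ℝ φ₀ x w‖ ≤ (R * ‖v‖) * (K * ‖w‖) := by
    rw [norm_mul]
    exact mul_le_mul ((norm_fderiv_apply_le' x v).trans (mul_le_mul_of_nonneg_right hRD hv0))
      ((norm_fderiv_apply_le' x w).trans (mul_le_mul_of_nonneg_right (hKg x) hw0)) (norm_nonneg _)
      (by positivity)
  have b3 : ‖U x * fderiv ℝ (fun y => fderiv ℝ φ₀ y v) x w‖ ≤ R * (K * ‖w‖ * ‖v‖) := by
    rw [norm_mul]
    refine mul_le_mul hRU ((norm_fderiv_fderiv_apply_le' hφ₀ x v w).trans ?_) (norm_nonneg _) hR0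
    gcongr
    exact hKgg x
  have b4 : ‖fderiv ℝ φ₀ x v * fderiv ℝ U x w‖ ≤ (K * ‖v‖) * (R * ‖w‖) := by
    rw [norm_mul]
    exact mul_le_mul ((norm_fderiv_apply_le' x v).trans (mul_le_mul_of_nonneg_right (hKg x) hv0))
      ((norm_fderiv_apply_le' x w).trans (mul_le_mul_of_nonneg_right hRD hw0)) (norm_nonneg _)
      (by positivity)
  calc ‖(φ₀ x * fderiv ℝ (fun y => fderiv ℝ U y v) x w + fderiv ℝ U x v * fderiv ℝ φ₀ x w) +
        (U x * fderiv ℝ (fun y => fderiv ℝ φ₀ y v) x w + fderiv ℝ φ₀ x v * fderiv ℝ U x w)‖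
      ≤ (‖φ₀ x * fderiv ℝ (fun y => fderiv ℝ U y v) x w‖ + ‖fderiv ℝ U x v * fderiv ℝ φ₀ x w‖) +
        (‖U x * fderiv ℝ (fun y => fderiv ℝ φ₀ y v) x w‖ + ‖fderiv ℝ φ₀ x v * fderiv ℝ U x w‖) :=
          (norm_add_le _ _).trans (add_le_add (norm_add_le _ _) (norm_add_le _ _))
    _ ≤ (K * (R * ‖w‖ * ‖v‖) + (R * ‖v‖) * (K * ‖w‖)) +
        (R * (K * ‖w‖ * ‖v‖) + (K * ‖v‖) * (R * ‖w‖)) :=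
          add_le_add (add_le_add b1 b2) (add_le_add b3 b4)
    _ = 4 * K * ‖v‖ * ‖w‖ * R := by ring

omit [MeasurableSpace E] [BorelSpace E] in
/-- `(|U| + ‖DU‖ + ‖D²U‖)² ≤ 3 (|U|² + Σᵢ|∂ᵢU|² + Σᵢⱼ|∂ⱼ∂ᵢU|²)` in the standard frame (operator norms
are dominated by frame sums). [folklore] -/
theorem pointwise_size_sq_le (U : E → ℝ) (x : E) :
    (‖U x‖ + ‖fderiv ℝ U x‖ + ‖fderiv ℝ (fderiv ℝ U) x‖) ^ 2 ≤
      3 * (‖U x‖ ^ 2 + ∑ i, ‖fderiv ℝ U x (stdOrthonormalBasis ℝ E i)‖ ^ 2 +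
        ∑ i, ∑ j, ‖fderiv ℝ (fun y => fderiv ℝ U y (stdOrthonormalBasis ℝ E i)) x
          (stdOrthonormalBasis ℝ E j)‖ ^ 2) := by
  set bs := stdOrthonormalBasis ℝ E
  have h1 : ‖fderiv ℝ U x‖ ^ 2 ≤ ∑ i, ‖fderiv ℝ U x (bs i)‖ ^ 2 := by
    have h := opNorm_le_sqrt_sum_sq bs (fderiv ℝ U x)
    have h0 : 0 ≤ ∑ i, ‖fderiv ℝ U x (bs i)‖ ^ 2 := Finset.sum_nonneg fun _ _ => by positivity
    calc ‖fderiv ℝ U x‖ ^ 2 ≤ (Real.sqrt (∑ i, ‖fderiv ℝ U x (bs i)‖ ^ 2)) ^ 2 := by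
          gcongr
      _ = ∑ i, ‖fderiv ℝ U x (bs i)‖ ^ 2 := Real.sq_sqrt h0
  have h2 := norm_fderiv_fderiv_sq_le_sum_sum (g := U) x
  have h3 : (‖U x‖ + ‖fderiv ℝ U x‖ + ‖fderiv ℝ (fderiv ℝ U) x‖) ^ 2 ≤
      3 * (‖U x‖ ^ 2 + ‖fderiv ℝ U x‖ ^ 2 + ‖fderiv ℝ (fderiv ℝ U) x‖ ^ 2) := by
    nlinarith [sq_nonneg (‖U x‖ - ‖fderiv ℝ U x‖), sq_nonneg (‖fderiv ℝ U x‖ - ‖fderiv ℝ (fderiv ℝ U) x‖),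
      sq_nonneg (‖U x‖ - ‖fderiv ℝ (fderiv ℝ U) x‖)]
  refine h3.trans ?_
  gcongr

end Pointwise

end Serrin

end Summit.NavierStokesRegularity.NavierStokesRegularity.Theorems.ScalingDefectPeepholeDoor

end
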